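import Summits.CriticalPhenomena.SAWScalingLimit.Theorems.SAWLoopFugacityFlowAvoidanceLimitAnchorDefs
import Summits.CriticalPhenomena.SAWScalingLimit.Theorems.SAWLoopFugacityFlowAvoidanceLimitSawEndpoint
import Literature.Probability.RandomPlanarGeometry.SupercriticalSAWPolygons
import Literature.Probability.RandomPlanarGeometry.HammersleyWelshBound
import Literature.Probability.RandomPlanarGeometry.SelfAvoidingWalkProofs
import Literature.Probability.RandomPlanarGeometry.BDGS2012Prop13
import Mathlib.Analysis.SpecificLimits.Basic

/-!
# Below `x_c` the corner-to-corner crossing of a square is massive — stub `stub_massiveBelow`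
of line `saw-corner-germ` (crux `SAWLoopFugacityFlow.AvoidanceLimit`, stmt-CriticalPhenomena-10649)

At `(n, t) = (0, 0)` the normalised two-leg function `twoLegDim 0 0 y G Λ a b` of the loop + dimer
dressed SAW of the Anchor Defs module is the two-point generating function `Σ_γ y^{|γ|}` of the
self-avoiding paths of `G` from `a` to `b` inside `Λ` (`Anchor.twoLegDim_zero_zero_eq_sum_paths`).
For the lattice square `Λ_k = [0, k]² ∩ ℤ²` (sites `(box 2 k).filter (∀ i, 0 ≤ v i)`), the corner `0`
and the opposite corner `SAW.diag k = (k, k)`, every such path is a self-avoiding walk of `ℤ²`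
from `0` to `(k, k)`, so for `0 < z < x_c = 1/μ`

`Σ_{γ : 0 → (k,k) in Λ_k} z^{|γ|} ≤ Σ_n c_n((k,k)) zⁿ = G_z((k,k)) ≤ A/(1-θ) · θ^{‖(k,k)‖₁} = C θ^{2k}`

by the subcritical two-point bound of Bauerschmidt–Duminil-Copin–Goodman–Slade (2012),
Proposition 1.3, PROVED in the tree as `SAW.Zd.exists_twoPoint_le_geometric` (`0 < θ < 1`; the walk
needs `≥ ‖(k,k)‖₁ = 2k` steps, and `c_n zⁿ ≤ A θⁿ` from `μ = inf c_n^{1/n}`). Since `C θ^k ≤ 1`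
for all large `k`, the corner-to-corner two-leg function is `≤ θ^k = e^{-mk}`, `m = -log θ > 0`,
eventually in `k`. For `0 ≤ y < x_c` one compares with `z = max y (x_c/2) ∈ (0, x_c)` termwise
(this also covers `y = 0`). This is STUB 1a of the line (`MassiveBelow`): half of
"the critical curve of the strictly dilute family passes through the SAW point, `critLine 0 = 1/μ`".

Sources: R. Bauerschmidt, H. Duminil-Copin, J. Goodman, G. Slade, *Lectures on self-avoiding
walks*, Clay Math. Proc. 15 (2012), Proposition 1.3 [BDGS2012]; N. Madras, G. Slade,
*The Self-Avoiding Walk* (1993), §1.2–1.3 [MadrasSlade1993]. No new definitions.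
-/

noncomputable section

open Set Filter Topology
open Literature.Probability.RandomPlanarGeometry Literature.Probability.LatticeModels
open Summit.CriticalPhenomena.SAWScalingLimit.Theorems.AvoidanceLimit.Anchor

namespace Summit.CriticalPhenomena.SAWScalingLimit.Theorems.AvoidanceLimit.Corner

/-- **The SAW generating function inside `Λ` is dominated by the full-lattice two-point function**:
for `0 < z < z_c(ℤ²) = x_c`, `Σ_{γ : 0 → b SAW of ℤ² in Λ} z^{|γ|} ≤ G_z(b) = Σ_n c_n(b) zⁿ`
(group the paths by length: those of length `n` are among the `c_n(b)` self-avoiding walks of `ℤ²`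
from `0` to `b`; the series converges below `z_c`). [cite: BDGS2012, §1.5.3, eq. (1.31)] -/
theorem sum_pathsIn_pow_length_le_twoPoint (Λ : Finset (Site 2)) (b : Site 2) {z : ℝ}
    (hz : 0 < z) (hzc : z < SAW.Zd.criticalPoint 2) :
    ∑ p ∈ DiluteLoopModel.pathsIn (zdGraph 2) Λ 0 b, z ^ p.length ≤ SAW.Zd.twoPoint 2 1 z b := by
  classical
  set S := DiluteLoopModel.pathsIn (zdGraph 2) Λ 0 b with hS
  -- each fibre `{γ ∈ S : |γ| = ℓ}` has at most `c_ℓ(b)` elements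
  have hfib : ∀ ℓ : ℕ, ∑ p ∈ S with p.length = ℓ, z ^ p.length ≤
      (SAW.Zd.countAt 2 ℓ b : ℝ) * z ^ ℓ := by
    intro ℓ
    have h1 : ∑ p ∈ S with p.length = ℓ, z ^ p.length = ∑ p ∈ S with p.length = ℓ, z ^ ℓ :=
      Finset.sum_congr rfl fun p hp => by rw [(Finset.mem_filter.1 hp).2]
    rw [h1, Finset.sum_const, nsmul_eq_mul]
    refine mul_le_mul_of_nonneg_right ?_ (pow_nonneg hz.le _)
    rw [← SAW.Zd.card_sawWalksAt]
    exact_mod_cast Finset.card_le_card fun p hp => by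
      rw [Finset.mem_filter, DiluteLoopModel.mem_pathsIn] at hp
      exact SAW.Zd.mem_sawWalksAt.2 ⟨hp.1.1, hp.2⟩
  -- `G_z(b) = Σ_n c_n(b) zⁿ`, a convergent series (`c_n(b) ≤ c_n`, `Σ c_n zⁿ < ∞` below `z_c`)
  have htsum : SAW.Zd.twoPoint 2 1 z b = ∑' n : ℕ, (SAW.Zd.countAt 2 n b : ℝ) * z ^ n := by
    simp [SAW.Zd.twoPoint, SAW.Zd.weaklyCountAt_one]
  have hle : ∀ n : ℕ, (SAW.Zd.countAt 2 n b : ℝ) * z ^ n ≤ (SAW.Zd.count 2 n : ℝ) * z ^ n :=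
    fun n => mul_le_mul_of_nonneg_right (by exact_mod_cast SAW.Zd.countAt_le_count n b)
      (pow_nonneg hz.le n)
  have hsum : Summable fun n : ℕ => (SAW.Zd.countAt 2 n b : ℝ) * z ^ n :=
    (SAW.Zd.summable_count_mul_pow hz hzc).of_nonneg_of_le (fun n => by positivity) hle
  calc ∑ p ∈ S, z ^ p.length
      = ∑ ℓ ∈ S.image fun p => p.length, ∑ p ∈ S with p.length = ℓ, z ^ p.length :=
        (Finset.sum_fiberwise_of_maps_to (fun p hp => Finset.mem_image_of_mem _ hp) _).symm
    _ ≤ ∑ ℓ ∈ S.image fun p => p.length, (SAW.Zd.countAt 2 ℓ b : ℝ) * z ^ ℓ :=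
        Finset.sum_le_sum fun ℓ _ => hfib ℓ
    _ ≤ ∑' ℓ : ℕ, (SAW.Zd.countAt 2 ℓ b : ℝ) * z ^ ℓ :=
        hsum.sum_le_tsum _ fun ℓ _ => by positivity
    _ = SAW.Zd.twoPoint 2 1 z b := htsum.symm

/-- `‖(k, k)‖₁ = 2k`. [folklore] -/
theorem normOne_diag (k : ℕ) : SAW.Zd.normOne (SAW.diag k) = 2 * k := by
  simp [SAW.Zd.normOne, SAW.diag]

/-- For `k ≥ 1` the corner `(k, k)` is not the origin. [folklore] -/
theorem zero_ne_diag {k : ℕ} (hk : 1 ≤ k) : (0 : Site 2) ≠ SAW.diag k := by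
  intro h
  have := congrFun h 0
  simp [SAW.diag] at this
  omega

/-- **STUB 1a of line `saw-corner-germ` — below `x_c` the square crossing is massive.** For
`0 ≤ y < x_c = 1/μ` there is `m > 0` such that, for all large `k`, the `(n, t) = (0, 0)` two-leg
function of the dressed SAW across the lattice square `[0, k]²` from the corner `0` to the corner
`(k, k)` — i.e. the generating function `Σ_γ y^{|γ|}` of the self-avoiding walks crossing the square
between opposite corners (DKY "squared walks" of span `k`, lengths `≥ 2k`) — is at most `e^{-mk}`:
it is dominated by the subcritical two-point function `G_z((k,k)) ≤ C θ^{2k}`, `z = max y (x_c/2)`,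
`θ < 1` (BDGS 2012, Proposition 1.3), and `C θ^{2k} ≤ θ^k = e^{-mk}` eventually, `m = -log θ`.
[cite: BDGS2012, Proposition 1.3] -/
theorem stub_massiveBelow :
    ∀ y : ℝ, 0 ≤ y → y < SAW.criticalFugacity → ∃ m : ℝ, 0 < m ∧ ∀ᶠ k : ℕ in atTop,
      twoLegDim (0 : ℝ) 0 y (zdGraph 2) ((box 2 k).filter fun v => ∀ i, 0 ≤ v i) 0 (SAW.diag k) ≤
        Real.exp (-(m * k)) := by
  intro y hy0 hyc
  have hxc : 0 < SAW.criticalFugacity := SAW.criticalFugacity_pos_lt_one'.1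
  -- compare with a POSITIVE subcritical fugacity `z = max y (x_c / 2)`
  set z : ℝ := max y (SAW.criticalFugacity / 2) with hz_def
  have hz : 0 < z := lt_max_of_lt_right (half_pos hxc)
  have hzc : z < SAW.Zd.criticalPoint 2 := max_lt hyc (half_lt_self hxc)
  have hyz : y ≤ z := le_max_left _ _
  obtain ⟨A, θ, hA, hθ0, hθ1, hb⟩ := SAW.Zd.exists_twoPoint_le_geometric (d := 2) hz hzc
  refine ⟨-Real.log θ, neg_pos.2 (Real.log_neg hθ0 hθ1), ?_⟩
  -- eventually `A/(1-θ) · θ^k ≤ 1`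
  have hev : ∀ᶠ k : ℕ in atTop, A / (1 - θ) * θ ^ k ≤ 1 := by
    have ht : Tendsto (fun k : ℕ => A / (1 - θ) * θ ^ k) atTop (𝓝 (A / (1 - θ) * 0)) :=
      (tendsto_pow_atTop_nhds_zero_of_lt_one hθ0.le hθ1).const_mul _
    rw [mul_zero] at ht
    exact ht.eventually (eventually_le_nhds one_pos)
  filter_upwards [hev, eventually_ge_atTop 1] with k hk hk1
  have hexp : Real.exp (-(-Real.log θ * k)) = θ ^ k := by
    rw [neg_mul, neg_neg, mul_comm, Real.exp_nat_mul, Real.exp_log hθ0]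
  rw [twoLegDim_zero_zero_eq_sum_paths (le_refl (zdGraph 2)) y _ (zero_ne_diag hk1), hexp]
  calc ∑ p ∈ DiluteLoopModel.pathsIn (zdGraph 2) ((box 2 k).filter fun v => ∀ i, 0 ≤ v i) 0
          (SAW.diag k), y ^ p.length
      ≤ ∑ p ∈ DiluteLoopModel.pathsIn (zdGraph 2) ((box 2 k).filter fun v => ∀ i, 0 ≤ v i) 0
          (SAW.diag k), z ^ p.length :=
        Finset.sum_le_sum fun p _ => pow_le_pow_left₀ hy0 hyz _
    _ ≤ SAW.Zd.twoPoint 2 1 z (SAW.diag k) := sum_pathsIn_pow_length_le_twoPoint _ _ hz hzc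
    _ ≤ A / (1 - θ) * θ ^ SAW.Zd.normOne (SAW.diag k) := hb _
    _ = A / (1 - θ) * θ ^ k * θ ^ k := by rw [normOne_diag, two_mul, pow_add, mul_assoc]
    _ ≤ 1 * θ ^ k := mul_le_mul_of_nonneg_right hk (pow_nonneg hθ0.le _)
    _ = θ ^ k := one_mul _

end Summit.CriticalPhenomena.SAWScalingLimit.Theorems.AvoidanceLimit.Corner

end
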